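import Summits.CriticalPhenomena.PercolationContinuityZ3.Theorems.PercNearOneGluingNoHeavyLowerTailSahiE3PrincipalMeet
import Literature.Probability.Percolation.ProdBernoulliRusso
import Literature.Probability.LatticeModels.SahiThirdOrderCorrelation
import Mathlib.Tactic.Linarith
import Mathlib.Tactic.Ring
import HarnessLib

/-!
# `NoHeavyLowerTail` (crux stmt-CriticalPhenomena-4575), Sahi programme P4: the principal-intersection theorem in the language of
# Kahn's Conjecture 5 (`sahiE3 (prodBernoulli p)` on `Set (Set ι)`)

Support file (cell `prim-l12`, seat P4, generation 3; `--supports stmt-CriticalPhenomena-4575`).  No named facts, no sorries, no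
definitions.  The tree states Kahn's Conjecture 5 / Sahi's `C₃` for product measures as
`Summit…Theorems.KahnConjecture : ∀ ι [Fintype ι] (p : ι → unitInterval) (A B C : Set (Set ι)), IsUpperSet A → IsUpperSet B →
IsUpperSet C → 0 ≤ sahiE3 (prodBernoulli p) A B C`.  This file transports the new proved class of `…SahiE3PrincipalMeet` (weighted-cube
`ED` calculus) into exactly that language.

* `prodBernoulli_real_eq_ED` — for a finite index type, `(prodBernoulli p)(B) = ED univ p (B.indicator 1)` (the cylinder formula
  `RussoPath.prodBernoulli_real_eq_sum_powerset`; `ED`, `wtW` of `Literature.Probability.Percolation.DecisionTree`).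
* `sahiE3_prodBernoulli_eq_ED` — `sahiE3 (prodBernoulli p) U A B` equals the `ED`-form `2E[ufg] + Eu·Ef·Eg − Eu·E[fg] − Ef·E[ug] − Eg·E[uf]`
  of the three indicator functions.
* **`kahn_of_inter_principal`** — KAHN'S CONJECTURE 5 HOLDS WHENEVER `A ∩ B` IS A PRINCIPAL UP-SET: for a finite index type `ι`,
  every `p : ι → [0,1]`, all increasing `U, A, B ⊆ Set ι` with `A ∩ B = {ω | ↑a ⊆ ω}` for some `a : Finset ι`:
  `0 ≤ sahiE3 (prodBernoulli p) U A B`  (and, by the symmetry of `E₃`, the same when `U ∩ A` or `U ∩ B` is principal: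
  `kahn_of_inter_principal₁₂`, `kahn_of_inter_principal₁₃`).  [this work]
-/

noncomputable section

open Classical

namespace Summit.CriticalPhenomena.PercolationContinuityZ3.Theorems

namespace SahiE3PrincipalMeet

open Finset MeasureTheory Literature.Probability.Percolation Literature.Probability.Percolation.DecisionTree
  Literature.Probability.LatticeModels

variable {ι : Type*} [Fintype ι] [DecidableEq ι]

/-- **The product measure of an event is the weighted-cube expectation of its indicator** (finite index type; all events are
cylinder events over `univ`). [folklore; `RussoPath.prodBernoulli_real_eq_sum_powerset`] -/
theorem prodBernoulli_real_eq_ED (p : ι → unitInterval) (B : Set (Set ι)) :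
    (prodBernoulli p).real B = ED (Finset.univ : Finset ι) (fun i => (p i : ℝ)) (fun S => B.indicator 1 (↑S : Set ι)) := by
  have hdet : DeterminedBy B (↑(Finset.univ : Finset ι) : Set ι) := by
    rw [Finset.coe_univ, determinedBy_iff]
    intro ω ω' h
    rw [Set.inter_univ, Set.inter_univ] at h
    rw [h]
  rw [RussoPath.prodBernoulli_real_eq_sum_powerset hdet]
  unfold ED wtW
  refine Finset.sum_congr rfl fun S _ => ?_
  beta_reduce
  by_cases h : (↑S : Set ι) ∈ B
  · rw [if_pos h, Set.indicator_of_mem h, Pi.one_apply, mul_one]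
  · rw [if_neg h, Set.indicator_of_notMem h, mul_zero]

omit [Fintype ι] [DecidableEq ι] in
/-- Indicator algebra: the indicator of an intersection is the product of the indicators. [folklore] -/
theorem indicator_inter_apply_eq_mul (X Y : Set (Set ι)) (ω : Set ι) :
    (X ∩ Y).indicator (1 : Set ι → ℝ) ω = X.indicator 1 ω * Y.indicator 1 ω := by
  rw [Set.inter_indicator_one, Pi.mul_apply]

/-- **Sahi's `E₃` under `prodBernoulli` in weighted-cube form** (indicators `𝟙_X = X.indicator 1`). [this work] -/
theorem sahiE3_prodBernoulli_eq_ED (p : ι → unitInterval) (U A B : Set (Set ι)) :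
    sahiE3 (prodBernoulli p) U A B
      = 2 * ED Finset.univ (fun i => (p i : ℝ)) (fun S => U.indicator 1 (↑S : Set ι) * A.indicator 1 (↑S : Set ι)
            * B.indicator 1 (↑S : Set ι))
        + ED Finset.univ (fun i => (p i : ℝ)) (fun S => U.indicator 1 (↑S : Set ι))
            * ED Finset.univ (fun i => (p i : ℝ)) (fun S => A.indicator 1 (↑S : Set ι))
            * ED Finset.univ (fun i => (p i : ℝ)) (fun S => B.indicator 1 (↑S : Set ι))
        - ED Finset.univ (fun i => (p i : ℝ)) (fun S => U.indicator 1 (↑S : Set ι))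
            * ED Finset.univ (fun i => (p i : ℝ)) (fun S => A.indicator 1 (↑S : Set ι) * B.indicator 1 (↑S : Set ι))
        - ED Finset.univ (fun i => (p i : ℝ)) (fun S => A.indicator 1 (↑S : Set ι))
            * ED Finset.univ (fun i => (p i : ℝ)) (fun S => U.indicator 1 (↑S : Set ι) * B.indicator 1 (↑S : Set ι))
        - ED Finset.univ (fun i => (p i : ℝ)) (fun S => B.indicator 1 (↑S : Set ι))
            * ED Finset.univ (fun i => (p i : ℝ)) (fun S => U.indicator 1 (↑S : Set ι) * A.indicator 1 (↑S : Set ι)) := by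
  rw [sahiE3_def, prodBernoulli_real_eq_ED, prodBernoulli_real_eq_ED, prodBernoulli_real_eq_ED, prodBernoulli_real_eq_ED,
    prodBernoulli_real_eq_ED, prodBernoulli_real_eq_ED, prodBernoulli_real_eq_ED]
  have e3 : ED Finset.univ (fun i => (p i : ℝ)) (fun S => (U ∩ A ∩ B).indicator 1 (↑S : Set ι))
      = ED Finset.univ (fun i => (p i : ℝ)) (fun S => U.indicator 1 (↑S : Set ι) * A.indicator 1 (↑S : Set ι)
          * B.indicator 1 (↑S : Set ι)) :=
    ED_congr_sub _ _ fun S _ => by rw [indicator_inter_apply_eq_mul, indicator_inter_apply_eq_mul]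
  have eAB : ED Finset.univ (fun i => (p i : ℝ)) (fun S => (A ∩ B).indicator 1 (↑S : Set ι))
      = ED Finset.univ (fun i => (p i : ℝ)) (fun S => A.indicator 1 (↑S : Set ι) * B.indicator 1 (↑S : Set ι)) :=
    ED_congr_sub _ _ fun S _ => by rw [indicator_inter_apply_eq_mul]
  have eUB : ED Finset.univ (fun i => (p i : ℝ)) (fun S => (U ∩ B).indicator 1 (↑S : Set ι))
      = ED Finset.univ (fun i => (p i : ℝ)) (fun S => U.indicator 1 (↑S : Set ι) * B.indicator 1 (↑S : Set ι)) :=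
    ED_congr_sub _ _ fun S _ => by rw [indicator_inter_apply_eq_mul]
  have eUA : ED Finset.univ (fun i => (p i : ℝ)) (fun S => (U ∩ A).indicator 1 (↑S : Set ι))
      = ED Finset.univ (fun i => (p i : ℝ)) (fun S => U.indicator 1 (↑S : Set ι) * A.indicator 1 (↑S : Set ι)) :=
    ED_congr_sub _ _ fun S _ => by rw [indicator_inter_apply_eq_mul]
  rw [e3, eAB, eUB, eUA]
  ring

omit [Fintype ι] [DecidableEq ι] in
/-- Indicators of increasing events are monotone along `⊆` on finite configurations. [folklore] -/
theorem indicator_mono_of_isUpperSet {X : Set (Set ι)} (hX : IsUpperSet X) ⦃S T : Finset ι⦄ (hST : S ⊆ T) :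
    X.indicator (1 : Set ι → ℝ) (↑S : Set ι) ≤ X.indicator 1 (↑T : Set ι) := by
  by_cases hS : (↑S : Set ι) ∈ X
  · rw [Set.indicator_of_mem hS, Set.indicator_of_mem (hX (Finset.coe_subset.2 hST) hS), Pi.one_apply, Pi.one_apply]
  · rw [Set.indicator_of_notMem hS]
    exact Set.indicator_nonneg (fun _ _ => zero_le_one) _

/-- **Kahn's Conjecture 5 holds whenever `A ∩ B` is a principal up-set.**  For a finite index type `ι`, every
`p : ι → [0,1]`, and increasing `U, A, B ⊆ Set ι` with `A ∩ B = {ω | ↑a ⊆ ω}` (`a : Finset ι`):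
`0 ≤ sahiE3 (prodBernoulli p) U A B = 2μ(UAB) + μUμAμB − μUμ(AB) − μAμ(UB) − μBμ(UA)`.
[this work; `sahiE3_nonneg_of_mul_eq_cylinder` transported by `sahiE3_prodBernoulli_eq_ED`] -/
theorem kahn_of_inter_principal (p : ι → unitInterval) (a : Finset ι) {U A B : Set (Set ι)} (hU : IsUpperSet U)
    (hA : IsUpperSet A) (hB : IsUpperSet B) (hAB : ∀ ω : Set ι, ω ∈ A ∩ B ↔ (↑a : Set ι) ⊆ ω) :
    0 ≤ sahiE3 (prodBernoulli p) U A B := by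
  rw [sahiE3_prodBernoulli_eq_ED]
  have huniv : a ∪ (Finset.univ \ a) = (Finset.univ : Finset ι) := Finset.union_sdiff_of_subset (Finset.subset_univ a)
  rw [← huniv]
  refine sahiE3_nonneg_of_mul_eq_cylinder a (Finset.univ \ a) Finset.disjoint_sdiff
    (fun i => (p i).2.1) (fun i => (p i).2.2) (indicator_mono_of_isUpperSet hU)
    (fun S => Set.indicator_nonneg (fun _ _ => zero_le_one) _) (indicator_mono_of_isUpperSet hA)
    (fun S => Set.indicator_nonneg (fun _ _ => zero_le_one) _) (indicator_mono_of_isUpperSet hB)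
    (fun S => Set.indicator_nonneg (fun _ _ => zero_le_one) _) fun S _ => ?_
  rw [← indicator_inter_apply_eq_mul]
  by_cases h : a ⊆ S
  · rw [if_pos h, Set.indicator_of_mem ((hAB _).2 (Finset.coe_subset.2 h)), Pi.one_apply]
  · rw [if_neg h, Set.indicator_of_notMem (fun h' => h (Finset.coe_subset.1 ((hAB _).1 h')))]

/-- The same with the principal intersection in the pair `(U, A)` (symmetry of `E₃`). [this work] -/
theorem kahn_of_inter_principal₁₂ (p : ι → unitInterval) (a : Finset ι) {U A B : Set (Set ι)} (hU : IsUpperSet U)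
    (hA : IsUpperSet A) (hB : IsUpperSet B) (hUA : ∀ ω : Set ι, ω ∈ U ∩ A ↔ (↑a : Set ι) ⊆ ω) :
    0 ≤ sahiE3 (prodBernoulli p) U A B := by
  rw [sahiE3_comm₂₃, sahiE3_comm₁₂]
  exact kahn_of_inter_principal p a hB hU hA hUA

/-- The same with the principal intersection in the pair `(U, B)` (symmetry of `E₃`). [this work] -/
theorem kahn_of_inter_principal₁₃ (p : ι → unitInterval) (a : Finset ι) {U A B : Set (Set ι)} (hU : IsUpperSet U)
    (hA : IsUpperSet A) (hB : IsUpperSet B) (hUB : ∀ ω : Set ι, ω ∈ U ∩ B ↔ (↑a : Set ι) ⊆ ω) :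
    0 ≤ sahiE3 (prodBernoulli p) U A B := by
  rw [sahiE3_comm₁₂]
  exact kahn_of_inter_principal p a hA hU hB hUB

end SahiE3PrincipalMeet

end Summit.CriticalPhenomena.PercolationContinuityZ3.Theorems

end
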